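import Mathlib
import Summits.Ventures.PercRepro2.CrossAPrimeA2Route
import Summits.Ventures.PercRepro2.Independence

/-!
# The two-route class, I: forcing edges open, clusters off a path, the route masses
(blind cell PercRepro2, p5 g35; S4 §2.4 (s) addendum 33; continued in `CrossAPrimeTwoRoutes`)

Tools for the two-route theorem: `forceOpen τ ω` (a finite set of edges forced open) and its
dependence on the edges off `τ`; `cluster_eq_of_eqOn_compl` — flipping edges whose endpoints lie
in `insert a₁ W` does not change a cluster avoiding `insert a₁ W` (from `cluster_eq_of_eqOn_touches`),
so the events `{a₂ ↮ insert a₁ W} ∩ {z ∈ C(a₂)}` are determined by the edges off such a path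
(`dependsOn_avoid_conn`); the product rules `prob_inter_allOpen` (an event determined off `τ` is
independent of `{τ open}`) and `prob_allOpen_union` (`P(π₁ open ∪ π₂ open) = p₁ + p₂ − p₁p₂`);
and the route masses: `P(Q, z ∈ K, π open) = p_π · P(Q_W, z ∈ K)` for a path `π` on `insert a₁ W`
connecting `a₁` to `W` (`prob_Q_conn_allOpen`), the vanishing `P(Q, z ∈ K, π open) = 0` for a
route vertex `z` (`prob_Q_conn_allOpen_eq_zero`, `not_allOpen_of_mem`) and the degenerate bound
`P(Q, z ∈ K) ≤ 1 − p_π` (`prob_Q_conn_le_one_sub`).  Own work; standard axioms.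
-/

namespace Summit.Ventures.PercRepro2

open LeafRowPendantRootSO CrossAPrimeA2Route

namespace CrossAPrimeTwoRoutes

section Forcing

variable {V : Type*} {E : Type*} [DecidableEq E] {ends : E → Sym2 V}

/-- Forcing a finite set of edges open. -/
def forceOpen (τ : Finset E) (ω : Config E) : Config E := fun e => if e ∈ τ then true else ω e

/-- Forcing edges open only increases the configuration. -/
lemma le_forceOpen (τ : Finset E) (ω : Config E) : ω ≤ forceOpen τ ω := by
  intro e
  unfold forceOpen
  split_ifs
  · exact Bool.le_true _
  · exact le_rfl

/-- After forcing `τ` open, `τ` is open. -/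
lemma forceOpen_mem_allOpen (τ : Finset E) (ω : Config E) : forceOpen τ ω ∈ allOpen τ := by
  intro e he
  simp [forceOpen, he]

/-- Forcing open does nothing on a configuration where `τ` is already open. -/
lemma forceOpen_eq_of_mem_allOpen {τ : Finset E} {ω : Config E} (h : ω ∈ allOpen τ) :
    forceOpen τ ω = ω := by
  funext e
  unfold forceOpen
  split_ifs with he
  · exact (h e he).symm
  · rfl

/-- `ω ↦ ω[τ ↦ open]` only reads the edges off `τ`. -/
lemma forceOpen_eq_of_eqOn {τ : Finset E} {ω ω' : Config E}
    (h : ∀ e ∈ ((↑τ : Set E)ᶜ), ω e = ω' e) : forceOpen τ ω = forceOpen τ ω' := by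
  funext e
  unfold forceOpen
  split_ifs with he
  · rfl
  · exact h e he

omit [DecidableEq E] in
/-- `{τ open}` is determined by the edges of `τ`. -/
lemma dependsOn_allOpen (τ : Finset E) : DependsOn (· ∈ allOpen τ) (↑τ : Set E) := by
  intro ω ω' h
  apply propext
  simp only [mem_allOpen]
  constructor
  · intro hω e he
    rw [← h e he]
    exact hω e he
  · intro hω e he
    rw [h e he]
    exact hω e he

end Forcing

section Cluster

variable {V : Type*} {E : Type*} [DecidableEq E] [DecidableEq V] {ends : E → Sym2 V}

omit [DecidableEq E] in
/-- Edges living on `insert a₁ W` do not touch a cluster avoiding `insert a₁ W`. -/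
lemma notMem_touches_of_avoid {π : Finset E} {a₁ : V} {W : Finset V}
    (hπ : ∀ e ∈ π, ∀ x, x ∈ ends e → x = a₁ ∨ x ∈ W) {ω : Config E} {a₂ : V}
    (hω : ω ∈ avoidAll ends a₂ (insert a₁ W)) {e : E} (he : e ∈ π) :
    e ∉ touches ends (cluster ends ω a₂) := by
  rintro ⟨x, hx, y, hxy⟩
  have hxe : x ∈ ends e := by rw [hxy]; exact Sym2.mem_mk_left x y
  rcases hπ e he x hxe with rfl | hxW
  · exact hω x (Finset.mem_insert_self x W) hx
  · exact hω x (Finset.mem_insert_of_mem hxW) hx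

/-- **Flipping edges off the cluster keeps it**: if `ω` and `ω'` agree off `π`, whose edges live
on `insert a₁ W`, and `C_ω(a₂)` avoids `insert a₁ W`, then `C_{ω'}(a₂) = C_ω(a₂)`. -/
lemma cluster_eq_of_eqOn_compl {π : Finset E} {a₁ : V} {W : Finset V}
    (hπ : ∀ e ∈ π, ∀ x, x ∈ ends e → x = a₁ ∨ x ∈ W) {ω ω' : Config E}
    (h : ∀ e ∈ ((↑π : Set E)ᶜ), ω e = ω' e) {a₂ : V}
    (hω : ω ∈ avoidAll ends a₂ (insert a₁ W)) :
    cluster ends ω' a₂ = cluster ends ω a₂ := by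
  refine cluster_eq_of_eqOn_touches (fun e he => ?_) rfl
  by_cases hπe : e ∈ π
  · exact absurd he (notMem_touches_of_avoid hπ hω hπe)
  · exact h e hπe

/-- The avoidance-with-membership events `{a₂ ↮ insert a₁ W} ∩ {z ∈ C(a₂)}` are determined by
the edges off `π`. -/
lemma dependsOn_avoid_conn {π : Finset E} {a₁ : V} {W : Finset V}
    (hπ : ∀ e ∈ π, ∀ x, x ∈ ends e → x = a₁ ∨ x ∈ W) (a₂ z : V) :
    DependsOn (· ∈ avoidAll ends a₂ (insert a₁ W) ∩ connEvent ends a₂ z) ((↑π : Set E)ᶜ) := by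
  intro ω ω' h
  apply propext
  have key : ∀ ω ω' : Config E, (∀ e ∈ ((↑π : Set E)ᶜ), ω e = ω' e) →
      ω ∈ avoidAll ends a₂ (insert a₁ W) ∩ connEvent ends a₂ z →
      ω' ∈ avoidAll ends a₂ (insert a₁ W) ∩ connEvent ends a₂ z := by
    intro ω ω' h hω
    have hc := cluster_eq_of_eqOn_compl hπ h hω.1
    refine ⟨fun x hx hconn => hω.1 x hx ?_, ?_⟩
    · have : x ∈ cluster ends ω' a₂ := hconn
      rw [hc] at this
      exact this
    · have : z ∈ cluster ends ω a₂ := hω.2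
      rw [← hc] at this
      exact this
  exact ⟨key ω ω' h, key ω' ω fun e he => (h e he).symm⟩

/-- The plain avoidance event is determined by the edges off `π` as well. -/
lemma dependsOn_avoid {π : Finset E} {a₁ : V} {W : Finset V}
    (hπ : ∀ e ∈ π, ∀ x, x ∈ ends e → x = a₁ ∨ x ∈ W) (a₂ : V) :
    DependsOn (· ∈ avoidAll ends a₂ (insert a₁ W)) ((↑π : Set E)ᶜ) := by
  intro ω ω' h
  apply propext
  have key : ∀ ω ω' : Config E, (∀ e ∈ ((↑π : Set E)ᶜ), ω e = ω' e) →
      ω ∈ avoidAll ends a₂ (insert a₁ W) → ω' ∈ avoidAll ends a₂ (insert a₁ W) := by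
    intro ω ω' h hω
    have hc := cluster_eq_of_eqOn_compl hπ h hω
    intro x hx hconn
    apply hω x hx
    have : x ∈ cluster ends ω' a₂ := hconn
    rw [hc] at this
    exact this
  exact ⟨key ω ω' h, key ω' ω fun e he => (h e he).symm⟩

end Cluster

section Product

variable {V : Type*} {E : Type*} [Fintype E] [DecidableEq E] {R : Type*} [Field R]
  [LinearOrder R] [IsStrictOrderedRing R]
variable {ends : E → Sym2 V}

omit [LinearOrder R] [IsStrictOrderedRing R] in
/-- An event determined by the edges off `τ` is independent of `{τ open}`. -/
lemma prob_inter_allOpen (p : E → R) (τ : Finset E) {A : Set (Config E)}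
    (hA : DependsOn (· ∈ A) ((↑τ : Set E)ᶜ)) :
    prob p (A ∩ allOpen τ) = prob p A * ∏ e ∈ τ, p e := by
  rw [← prob_allOpen p τ]
  exact prob_inter_eq_mul_of_dependsOn p disjoint_compl_left hA (dependsOn_allOpen τ)

omit [LinearOrder R] [IsStrictOrderedRing R] in
/-- The route probability `P(π₁ open ∪ π₂ open) = p₁ + p₂ − p₁p₂` for disjoint edge sets. -/
lemma prob_allOpen_union (p : E → R) {π₁ π₂ : Finset E} (hd : Disjoint π₁ π₂) :
    prob p (allOpen π₁ ∪ allOpen π₂) =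
      ∏ e ∈ π₁, p e + ∏ e ∈ π₂, p e - (∏ e ∈ π₁, p e) * ∏ e ∈ π₂, p e := by
  have h := prob_union_add_prob_inter p (allOpen π₁) (allOpen π₂)
  have hi : prob p (allOpen π₁ ∩ allOpen π₂) = (∏ e ∈ π₁, p e) * ∏ e ∈ π₂, p e := by
    rw [← prob_allOpen p π₁, ← prob_allOpen p π₂]
    exact prob_inter_eq_mul_of_dependsOn p (Finset.disjoint_coe.2 hd) (dependsOn_allOpen π₁)
      (dependsOn_allOpen π₂)
  rw [hi, prob_allOpen, prob_allOpen] at h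
  linear_combination h

end Product

section Masses

variable {V : Type*} {E : Type*} [Fintype E] [DecidableEq E] [DecidableEq V] {R : Type*} [Field R]
  [LinearOrder R] [IsStrictOrderedRing R]
variable {ends : E → Sym2 V}

omit [Fintype E] [DecidableEq E] [LinearOrder R] [IsStrictOrderedRing R] in
/-- On `Q`, an open path from `a₁` through `W` keeps the cluster off `W`: `Q ∩ {π open} ⊆ Q_W`. -/
lemma avoid_of_allOpen {π : Finset E} {a₁ : V} {W : Finset V}
    (hconn : ∀ ω ∈ allOpen π, ∀ x ∈ W, Conn ends ω a₁ x) {ω : Config E} {a₂ : V}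
    (hQ : ω ∈ avoidAll ends a₂ {a₁}) (hπ : ω ∈ allOpen π) :
    ω ∈ avoidAll ends a₂ (insert a₁ W) := by
  intro x hx hconn'
  rcases Finset.mem_insert.1 hx with rfl | hxW
  · exact hQ x (Finset.mem_singleton_self x) hconn'
  · exact hQ a₁ (Finset.mem_singleton_self a₁) (conn_trans hconn' (conn_symm (hconn ω hπ x hxW)))

omit [LinearOrder R] [IsStrictOrderedRing R] in
/-- `P(Q, z ∈ K, π open) = p_π · P(Q_W, z ∈ K)` when `π` lives on `insert a₁ W` and connects
`a₁` to `W`. -/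
lemma prob_Q_conn_allOpen (p : E → R) {π : Finset E} {a₁ : V} {W : Finset V}
    (hπ : ∀ e ∈ π, ∀ x, x ∈ ends e → x = a₁ ∨ x ∈ W)
    (hconn : ∀ ω ∈ allOpen π, ∀ x ∈ W, Conn ends ω a₁ x) (a₂ z : V) :
    prob p (avoidAll ends a₂ {a₁} ∩ connEvent ends a₂ z ∩ allOpen π) =
      (∏ e ∈ π, p e) * prob p (avoidAll ends a₂ (insert a₁ W) ∩ connEvent ends a₂ z) := by
  have e1 : avoidAll ends a₂ {a₁} ∩ connEvent ends a₂ z ∩ allOpen π =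
      avoidAll ends a₂ (insert a₁ W) ∩ connEvent ends a₂ z ∩ allOpen π := by
    ext ω
    simp only [Set.mem_inter_iff]
    constructor
    · rintro ⟨⟨hQ, hz⟩, hπ'⟩
      exact ⟨⟨avoid_of_allOpen hconn hQ hπ', hz⟩, hπ'⟩
    · rintro ⟨⟨hQ, hz⟩, hπ'⟩
      refine ⟨⟨fun x hx => hQ x (by rw [Finset.mem_singleton] at hx; rw [hx]; exact Finset.mem_insert_self a₁ W), hz⟩, hπ'⟩
  rw [e1, prob_inter_allOpen p π (dependsOn_avoid_conn hπ a₂ z), mul_comm]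

omit [DecidableEq V] [LinearOrder R] [IsStrictOrderedRing R] in
/-- The same with the membership of two vertices: `P(Q, z ∈ K, z' ∈ K, π open) = 0` when one of
them lies on the path. -/
lemma prob_Q_conn_allOpen_eq_zero (p : E → R) {π : Finset E} {a₁ : V} {W : Finset V}
    (hconn : ∀ ω ∈ allOpen π, ∀ x ∈ W, Conn ends ω a₁ x) {z : V} (hz : z ∈ W) (a₂ : V)
    (A : Set (Config E)) :
    prob p (avoidAll ends a₂ {a₁} ∩ (connEvent ends a₂ z ∩ A) ∩ allOpen π) = 0 := by
  have : avoidAll ends a₂ {a₁} ∩ (connEvent ends a₂ z ∩ A) ∩ allOpen π = ∅ := by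
    ext ω
    simp only [Set.mem_inter_iff, Set.mem_empty_iff_false, iff_false, not_and]
    rintro ⟨hQ, hz', -⟩ hπ
    exact hQ a₁ (Finset.mem_singleton_self a₁) (conn_trans hz' (conn_symm (hconn ω hπ z hz)))
  rw [this, prob_empty]

end Masses

section Degenerate

variable {V : Type*} {E : Type*} [Fintype E] [DecidableEq E] [DecidableEq V] {R : Type*} [Field R]
  [LinearOrder R] [IsStrictOrderedRing R]
variable {ends : E → Sym2 V}

omit [Fintype E] [DecidableEq E] [DecidableEq V] [LinearOrder R] [IsStrictOrderedRing R] in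
/-- On `Q`, the membership of a route vertex excludes that route. -/
lemma not_allOpen_of_mem {π : Finset E} {a₁ : V} {W : Finset V}
    (hconn : ∀ ω ∈ allOpen π, ∀ x ∈ W, Conn ends ω a₁ x) {z : V} (hz : z ∈ W) {ω : Config E}
    {a₂ : V} (hQ : ω ∈ avoidAll ends a₂ {a₁}) (hzK : ω ∈ connEvent ends a₂ z) :
    ω ∉ allOpen π :=
  fun hπ => hQ a₁ (Finset.mem_singleton_self a₁) (conn_trans hzK (conn_symm (hconn ω hπ z hz)))

omit [DecidableEq V] in
/-- The degenerate bound: `P(Q, z ∈ K) ≤ 1 − p_π` for a route vertex `z`. -/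
lemma prob_Q_conn_le_one_sub (p : E → R) (hp : IsProbVec p) {π : Finset E} {a₁ : V}
    {W : Finset V} (hconn : ∀ ω ∈ allOpen π, ∀ x ∈ W, Conn ends ω a₁ x) {z : V} (hz : z ∈ W)
    (a₂ : V) :
    prob p (avoidAll ends a₂ {a₁} ∩ connEvent ends a₂ z) ≤ 1 - ∏ e ∈ π, p e := by
  have hsplit := prob_inter_add_prob_inter_compl p (avoidAll ends a₂ {a₁} ∩ connEvent ends a₂ z)
    (allOpen π)
  have h0 : prob p (avoidAll ends a₂ {a₁} ∩ connEvent ends a₂ z ∩ allOpen π) = 0 := by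
    have : avoidAll ends a₂ {a₁} ∩ connEvent ends a₂ z ∩ allOpen π = ∅ := by
      ext ω
      simp only [Set.mem_inter_iff, Set.mem_empty_iff_false, iff_false, not_and]
      rintro ⟨hQ, hzK⟩ hπ
      exact not_allOpen_of_mem hconn hz hQ hzK hπ
    rw [this, prob_empty]
  have h1 : prob p (avoidAll ends a₂ {a₁} ∩ connEvent ends a₂ z ∩ (allOpen π)ᶜ) ≤
      prob p (allOpen π)ᶜ := prob_mono hp Set.inter_subset_right
  rw [prob_compl, prob_allOpen] at h1
  linarith


end Degenerate


section MoreMasses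

variable {V : Type*} {E : Type*} [Fintype E] [DecidableEq E] [DecidableEq V] {R : Type*} [Field R]
  [LinearOrder R] [IsStrictOrderedRing R]
variable {ends : E → Sym2 V}

omit [Fintype E] [LinearOrder R] [IsStrictOrderedRing R] in
/-- The events `{a₂ ↮ insert a₁ W} ∩ {C(a₂) ∈ 𝓤}` are determined by the edges off a path `π` on
`insert a₁ W`. -/
lemma dependsOn_avoid_clusterIn {π : Finset E} {a₁ : V} {W : Finset V}
    (hπ : ∀ e ∈ π, ∀ x, x ∈ ends e → x = a₁ ∨ x ∈ W) (a₂ : V) (𝓤 : Set (Set V)) :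
    DependsOn (· ∈ avoidAll ends a₂ (insert a₁ W) ∩ clusterInEvent ends a₂ 𝓤)
      ((↑π : Set E)ᶜ) := by
  intro ω ω' h
  apply propext
  have key : ∀ ω ω' : Config E, (∀ e ∈ ((↑π : Set E)ᶜ), ω e = ω' e) →
      ω ∈ avoidAll ends a₂ (insert a₁ W) ∩ clusterInEvent ends a₂ 𝓤 →
      ω' ∈ avoidAll ends a₂ (insert a₁ W) ∩ clusterInEvent ends a₂ 𝓤 := by
    intro ω ω' h hω
    have hc := cluster_eq_of_eqOn_compl hπ h hω.1
    refine ⟨fun x hx hconn => hω.1 x hx ?_, ?_⟩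
    · have : x ∈ cluster ends ω' a₂ := hconn
      rw [hc] at this
      exact this
    · have : cluster ends ω a₂ ∈ 𝓤 := hω.2
      rw [← hc] at this
      exact this
  exact ⟨key ω ω' h, key ω' ω fun e he => (h e he).symm⟩

omit [LinearOrder R] [IsStrictOrderedRing R] in
/-- `P(Q, o, b ∈ K, π open) = p_π · P(Q_W, o, b ∈ K)`. -/
lemma prob_Q_conn_conn_allOpen (p : E → R) {π : Finset E} {a₁ : V} {W : Finset V}
    (hπ : ∀ e ∈ π, ∀ x, x ∈ ends e → x = a₁ ∨ x ∈ W)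
    (hconn : ∀ ω ∈ allOpen π, ∀ x ∈ W, Conn ends ω a₁ x) (a₂ o b : V) :
    prob p (avoidAll ends a₂ {a₁} ∩ (connEvent ends a₂ o ∩ connEvent ends a₂ b) ∩ allOpen π) =
      (∏ e ∈ π, p e) *
        prob p (avoidAll ends a₂ (insert a₁ W) ∩ (connEvent ends a₂ o ∩ connEvent ends a₂ b)) := by
  have e1 : avoidAll ends a₂ {a₁} ∩ (connEvent ends a₂ o ∩ connEvent ends a₂ b) ∩ allOpen π =
      avoidAll ends a₂ (insert a₁ W) ∩ (connEvent ends a₂ o ∩ connEvent ends a₂ b) ∩ allOpen π := by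
    ext ω
    simp only [Set.mem_inter_iff]
    constructor
    · rintro ⟨⟨hQ, hz⟩, hπ'⟩
      exact ⟨⟨avoid_of_allOpen hconn hQ hπ', hz⟩, hπ'⟩
    · rintro ⟨⟨hQ, hz⟩, hπ'⟩
      refine ⟨⟨fun x hx => hQ x (by rw [Finset.mem_singleton] at hx; rw [hx]; exact Finset.mem_insert_self a₁ W), hz⟩, hπ'⟩
  have e2 : connEvent ends a₂ o ∩ connEvent ends a₂ b =
      clusterInEvent ends a₂ ({A : Set V | o ∈ A} ∩ {A : Set V | b ∈ A}) := by
    ext ω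
    simp [connEvent, clusterInEvent, cluster]
  rw [e1, e2, prob_inter_allOpen p π (dependsOn_avoid_clusterIn hπ a₂ _), mul_comm]


end MoreMasses

section Algebra

variable {R : Type*} [Field R] [LinearOrder R] [IsStrictOrderedRing R]

/-- `d(1 − γp₁) ≤ y(1 − γ)` and `γ ≥ p₂` give `d(1 − p₁p₂) ≤ y(1 − p₂)` (with `d ≤ y`). -/
lemma tail_to_route {p₁ p₂ γ y d : R} (hp₁ : 0 ≤ p₁) (hp₁' : p₁ ≤ 1) (hp₂ : 0 ≤ p₂)
    (hγ : p₂ ≤ γ) (hγ' : γ ≤ 1) (hy : 0 ≤ y) (hdy : d ≤ y)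
    (h : d * (1 - γ * p₁) ≤ y * (1 - γ)) : d * (1 - p₁ * p₂) ≤ y * (1 - p₂) := by
  have hmono : (1 - γ) * (1 - p₁ * p₂) ≤ (1 - p₂) * (1 - γ * p₁) := by nlinarith
  rcases lt_or_eq_of_le (show γ * p₁ ≤ 1 by nlinarith) with hlt | heq
  · have hpos : 0 < 1 - γ * p₁ := by linarith
    have h0 : (0 : R) ≤ 1 - p₁ * p₂ := by nlinarith
    have k1 := mul_le_mul_of_nonneg_right h h0
    have k2 := mul_le_mul_of_nonneg_left hmono hy
    -- `d(1−γp₁)(1−p₁p₂) ≤ y(1−γ)(1−p₁p₂) ≤ y(1−p₂)(1−γp₁)`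
    have h' : (1 - γ * p₁) * (d * (1 - p₁ * p₂)) ≤ (1 - γ * p₁) * (y * (1 - p₂)) := by
      nlinarith [k1, k2]
    exact le_of_mul_le_mul_left h' hpos
  · -- `γ p₁ = 1`: then `γ = p₁ = 1`
    have hγ1 : γ = 1 := by nlinarith
    have hp11 : p₁ = 1 := by nlinarith
    subst hγ1 hp11
    nlinarith

/-- **The algebra of the two-route class**: `p₁·x·d_b + p₂·y·d_o ≤ (p₁ + p₂ − p₁p₂)·x·y` from the
two route bounds `d_b(1 − p₁p₂) ≤ y(1 − p₂)`, `d_o(1 − p₁p₂) ≤ x(1 − p₁)` and the degenerate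
bounds `x ≤ 1 − p₁`, `y ≤ 1 − p₂`. -/
lemma two_routes_algebra {p₁ p₂ x y d_b d_o : R} (hp₁ : 0 ≤ p₁) (hp₁' : p₁ ≤ 1) (hp₂ : 0 ≤ p₂)
    (hp₂' : p₂ ≤ 1) (hx : 0 ≤ x) (hy : 0 ≤ y)
    (hb : d_b * (1 - p₁ * p₂) ≤ y * (1 - p₂)) (ho : d_o * (1 - p₁ * p₂) ≤ x * (1 - p₁))
    (hx1 : x ≤ 1 - p₁) (hy1 : y ≤ 1 - p₂) :
    p₁ * x * d_b + p₂ * y * d_o ≤ (p₁ + p₂ - p₁ * p₂) * x * y := by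
  rcases lt_or_eq_of_le (show p₁ * p₂ ≤ 1 by nlinarith) with hlt | heq
  · have hpos : 0 < 1 - p₁ * p₂ := by linarith
    -- multiply the goal by `1 − p₁p₂`
    have h1 := mul_le_mul_of_nonneg_left hb (mul_nonneg hp₁ hx)
    have h2 := mul_le_mul_of_nonneg_left ho (mul_nonneg hp₂ hy)
    have hslack : 0 ≤ x * y * (p₁ * p₂ * ((1 - p₁) * (1 - p₂))) :=
      mul_nonneg (mul_nonneg hx hy) (mul_nonneg (mul_nonneg hp₁ hp₂)
        (mul_nonneg (by linarith) (by linarith)))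
    have key : (1 - p₁ * p₂) * (p₁ * x * d_b + p₂ * y * d_o) ≤
        (1 - p₁ * p₂) * ((p₁ + p₂ - p₁ * p₂) * x * y) := by nlinarith
    exact le_of_mul_le_mul_left key hpos
  · have hp11 : p₁ = 1 := by nlinarith
    have hp21 : p₂ = 1 := by nlinarith
    subst hp11 hp21
    have hx0 : x = 0 := le_antisymm (by linarith) hx
    have hy0 : y = 0 := le_antisymm (by linarith) hy
    subst hx0 hy0
    simp

end Algebra

end CrossAPrimeTwoRoutes

end Summit.Ventures.PercRepro2
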